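import Summits.BirchSwinnertonDyer.BirchSwinnertonDyer.Theorems.GoldfeldK12AdditiveTwoHalfTraceGenusInvolutions
import Summits.BirchSwinnertonDyer.BirchSwinnertonDyer.Theorems.GoldfeldK12AdditiveTwoHalfTraceLifts
import Literature.NumberTheory.EllipticCurves.BSDHeegnerPointsTorsionProofs
import HarnessLib

set_option linter.dupNamespace false -- namespace `…BirchSwinnertonDyer.BirchSwinnertonDyer…` is the cell's (D-0017 nested layout)
set_option autoImplicit false

/-!
# Conjunct (a) of `X049GenusHalfTraceFiveModEight` from Shimura reciprocity: the genus half-trace `z ∈ X₀(49)(J)`,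
# `J = ℚ(i, √−q) ⊂ H_K`, with `y = z + ρ z` and `z + τ z = T` — Theses-free core

Cell `bsd-goldfeld`, seat `bsd-goldfeld-s1p-c201` (prover, gen 13), order `ROUTE-S1PLUS/planner-g30/c201_GO.txt`;
`--supports stmt-BirchSwinnertonDyer-20044` (route decl
`Summit.BirchSwinnertonDyer.BirchSwinnertonDyer.Theses.GoldfeldAllTwistsTwoConverse.RankOneTwoConverseCMSevenAdditiveTwo`,
K12₂″). HONEST FRAMING: nothing here proves K12₂″ or BSD; the family `49a1^{(−q)}`, `q ≡ 5 (mod 8)` prime, has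
twist-density zero (a witness family, never a closer of item 20044).

MAIN THEOREMS (Theses-free; inputs BY NAME: the fact `heegnerPoints_shimuraReciprocity 49 cm7 K` (Darmon Thm. 3.7,
typer p527359), its companions `HeegnerPointsShimuraReciprocityProofs` (p529451: `[𝔫] = [𝔮₇]²` is a square at `N = 49`,
`H.reps ≃ Cl`) and `HeegnerPointsGenusHalfTraceProofs` (p530330: the summed reflection law, squares fix coset sums),
plus the files `…HalfTraceGenusField`, `…GenusInvolutions`, `…Lifts` of this seat):
* `exists_genusHalfTrace_points`: for `K = ℚ(√−q)` (`d_K = −4q`, `q ≡ 1 (mod 4)` prime), a parametrisation datum `D₀`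
  with `|c₀| = 1` and Fricke sign `−1`, `#Cl(𝒪_{d_K})²` odd and `φ_{D₀}(0) = T = (2, −1)`, and a point `P ∈ X₀(49)(K)`
  mapping to the Heegner point of ANY datum `Dt`: there are `θ`, the genus field `J = H_K^{θ(Cl²)}`, `γ₀ ∉ Cl²`,
  `ρ = θ(γ₀)|_J`, `z ∈ X₀(49)(J)` (the DESCENDED half-trace `Σ_{[𝔞_q] ∈ Cl²} P_q`) and `Y ∈ X₀(49)(K)` (the descended
  trace) with `P = Dt.c • D₀.c • Y`, `Y = z + ρ z` in `X₀(49)(J)`, and `z + τ z = T` for EVERY `ℚ`-automorphism `τ` of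
  `J` inducing complex conjugation — i.e. (HT), the `halfTrace`/`halfTrace_conj` fields of `X049GenusHalfTraceDatum`.
* `exists_genusHalfTrace_data`: the same packaged with the field data of `…GenusInvolutions` (`[J : ℚ] = 4`, `i`, `√q`,
  `τ i = −i`, `ρ i = −i`, `τ√q = √q`, `ρ√q = −√q`, `Fix(ρτ) = ℚ ⊕ ℚi`, `√−7 ∉ J`) — the interface of the cone file.
PROOF: descent (`…GenusField` §1) of the `θ(Cl²)`-fixed half-trace and of the `Gal`-fixed trace; `Σ_q P_q = z + θ(γ₀)z`
(`…Lifts`); `P` versus the optimal trace by `D₀.c • P_{Dt} = Dt.c • P_{D₀}` (tree `zsmul_heegnerPointComplex_eq`) and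
`|c₀| = 1`; (HT) in `E(ℂ)` (`halfTrace_add_conj_eq_T`) pulled back along the injective `J ⊂ H_K ⊂ ℂ`, using
`κ ∘ τ = conj ∘ κ`. Design: all instance-sensitive equalities are transported with `affinePoint_map_congr` /
`affinePoint_map_map_congr` and type ascriptions (the `ℚ`-algebra and `DecidableEq` structures on `↥J` have several
defeq-but-not-syntactic instance paths).

What is NOT here (residual, named in the cone file as explicit hypotheses): (b₂) `#Cl(𝒪_{−4q})²` odd ⟺ `4`-rank `0` ⟺
`q ≡ 5 (mod 8)` (Rédei; dischargeable from the tree's `redeiReichardt_fourTwoCard_classGroup_holds` once a bridge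
`ClassGroup (OrderCl.QO Δ) ≃* ClassGroup (𝓞 K)` is available); (c) ramification of `ℚ(i,√−q)/ℚ(i)` at `q`;
(d) `φ(0) = (2, −1)` for Manin-`±1` parametrisations (`L(49a1,1)/Ω⁺ = 1/2`); the Fricke sign (from `w(49a1) = +1`).

References: [GrossLMS1991] Prop. 5.3 and proof; [Darmon2004] Thm. 3.6, 3.7, Prop. 3.11; [Gross1984] §I.1, §5;
[Cox2013] §3.A Prop. 3.11, §6.A Thm. 6.1; [CoatesLiTianZhai2015] §2 (h2), Thm. 2.2 (odd class number analogue).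
-/

noncomputable section

open scoped Classical ComplexConjugate NNReal

open Literature.NumberTheory.EllipticCurves.ModularForms NumberField
open Literature.Computability.Cryptography.Hallgren2005
open Literature.Computability.Cryptography.Hallgren2005.OrderCl
open Literature.NumberTheory.QuadraticFields.Quadratic

namespace Summit.BirchSwinnertonDyer.BirchSwinnertonDyer.Theorems.GoldfeldGoodTwists

open WeierstrassCurve Literature.NumberTheory.EllipticCurves

/-! ## §8 The half-trace and the trace of the Heegner lifts, descended to the genus field -/

section Main

variable {K : Type} [Field K] [NumberField K]

/-- **The genus half-trace of the level-`49` Heegner points over `ℚ(√-q)`, from Shimura reciprocity.**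
[cite: GrossLMS1991, Prop. 5.3 and proof] [cite: Darmon2004, Thm. 3.7] [cite: Cox2013, §3.A Prop. 3.11, §6.A Thm. 6.1] -/
theorem exists_genusHalfTrace_points (hSR : heegnerPoints_shimuraReciprocity 49 cm7 K)
    (hK : IsImaginaryQuadratic K) (hH : SatisfiesHeegnerHypothesis 49 K) {q : ℕ} (hq : q.Prime)
    (hq4 : q % 4 = 1) (hdK : NumberField.discr K = -(4 * (q : ℤ)))
    (Dt D₀ : ModularParametrizationData cm7 49) (hD₀ : |D₀.c| = 1) (H : HeegnerDatum 49 (NumberField.discr K))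
    (ι : K →+* ℂ) (hW : ModularForms.IsFrickeEigen 49 D₀.f ((-1 : ℤ) : ℂ))
    (hodd : Odd (Nat.card ((powMonoidHom 2 : ClassGroup (OrderCl.QO hK.negDiscr) →* _).range)))
    (hcusp : D₀.cuspZeroPoint = Affine.Point.some 2 (-1) (nonsingular_cm7_baseChange_two_neg_one ℂ))
    {P : (cm7.baseChange K).toAffine.Point}
    (hP : Affine.Point.map ι.toRatAlgHom P = heegnerPointComplex Dt H) :
    ∃ (θ : ClassGroup (OrderCl.QO hK.negDiscr) ≃* Gal(singularModuliField K ι/K))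
      (J : IntermediateField K (singularModuliField K ι))
      (_ : J = IntermediateField.fixedField
          (((powMonoidHom 2 : ClassGroup (OrderCl.QO hK.negDiscr) →* _).range).map θ.toMonoidHom))
      (γ₀ : ClassGroup (OrderCl.QO hK.negDiscr)) (_ : ∀ δ, γ₀ ≠ δ ^ 2)
      (ρ : J ≃ₐ[K] J) (_ : ∀ x : J, ((ρ x : J) : singularModuliField K ι) = θ γ₀ x)
      (z : (cm7.baseChange J).toAffine.Point) (Y : (cm7.baseChange K).toAffine.Point),
      P = Dt.c • (D₀.c • Y) ∧
      Affine.Point.map (Algebra.ofId K J) Y = z + Affine.Point.map ρ.toAlgHom z ∧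
      ∀ τ : J ≃ₐ[ℚ] J, (∀ x : J, (((τ x : J) : singularModuliField K ι) : ℂ) =
          conj ((x : singularModuliField K ι) : ℂ)) →
        z + Affine.Point.map τ.toAlgHom z =
          Affine.Point.some 2 (-1) (nonsingular_cm7_baseChange_two_neg_one J) := by
  obtain ⟨hfd, hgal⟩ := finiteDimensional_and_isGalois_singularModuliField irreducible_classPolynomial_holds hK ι
  obtain ⟨Pf, θ, hPf, hθ⟩ := hSR hK hH D₀ H ι
  set S := ((powMonoidHom 2 : ClassGroup (OrderCl.QO hK.negDiscr) →* _).range).map θ.toMonoidHom with hS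
  -- index 2 and an element outside the squares
  have hS2 : (powMonoidHom 2 : ClassGroup (OrderCl.QO hK.negDiscr) →* _).range.index = 2 :=
    index_range_sq_classGroup_negFourPrime hK.negDiscr hq hq4 (by rw [IsImaginaryQuadratic.negDiscr_D, hdK])
  obtain ⟨γ₀, hγ₀S⟩ : ∃ γ₀, γ₀ ∉ (powMonoidHom 2 : ClassGroup (OrderCl.QO hK.negDiscr) →* _).range := by
    by_contra! h
    have : (powMonoidHom 2 : ClassGroup (OrderCl.QO hK.negDiscr) →* _).range = ⊤ :=
      (Subgroup.eq_top_iff' _).mpr h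
    rw [this, Subgroup.index_top] at hS2
    exact absurd hS2 (by norm_num)
  have hγ₀ : ∀ δ, γ₀ ≠ δ ^ 2 := fun δ h ↦ hγ₀S ⟨δ, by rw [powMonoidHom_apply, h]⟩
  -- the lifted half-trace and trace
  set zH := ∑ q ∈ Finset.univ.filter (fun q : H.reps ↦ ∃ δ, heegnerFormClass hK q = δ ^ 2 * 1), Pf q with hzH
  have hzfix : ∀ g ∈ S, Affine.Point.map (g : singularModuliField K ι →ₐ[K] singularModuliField K ι) zH = zH := by
    intro g hg
    obtain ⟨δ, rfl⟩ := (mem_map_range_sq_iff θ g).mp hg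
    exact map_sq_sum_sqCoset hK H ι Pf θ hθ 1 δ
  obtain ⟨zJ, hzJ⟩ : ∃ zJ : (cm7.baseChange (IntermediateField.fixedField S)).toAffine.Point,
      Affine.Point.map (IntermediateField.fixedField S).val zJ = zH :=
    exists_map_val_eq_of_forall_map_eq cm7 S zH hzfix
  have hYfix : ∀ g : Gal(singularModuliField K ι/K),
      Affine.Point.map (g : singularModuliField K ι →ₐ[K] singularModuliField K ι) (∑ q, Pf q) = ∑ q, Pf q := by
    intro g
    have h := map_sum_filter_eq_of_stable hK H ι Pf θ hθ (θ.symm g) (fun _ ↦ True) (fun _ ↦ Iff.rfl)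
    rw [Finset.filter_true, MulEquiv.apply_symm_apply] at h
    exact h
  obtain ⟨YK, hYK⟩ : ∃ YK : (cm7.baseChange K).toAffine.Point,
      Affine.Point.map (Algebra.ofId K (singularModuliField K ι)) YK = ∑ q, Pf q :=
    exists_map_eq_of_forall_gal cm7 (∑ q, Pf q) hYfix
  have hdec : ∑ q, Pf q = zH + Affine.Point.map (θ γ₀).toAlgHom zH :=
    sum_eq_halfTrace_add_map hK H ι Pf θ hθ hS2 hγ₀
  obtain ⟨ρ, hρ⟩ : ∃ ρ : IntermediateField.fixedField S ≃ₐ[K] IntermediateField.fixedField S,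
      ∀ x, ((ρ x : IntermediateField.fixedField S) : singularModuliField K ι) = θ γ₀ x :=
    exists_algEquiv_restrict_fixedField hK ι θ (θ γ₀)
  refine ⟨θ, IntermediateField.fixedField S, rfl, γ₀, hγ₀, ρ, hρ, zJ, YK, ?_, ?_, ?_⟩
  · -- `P = Dt.c • D₀.c • Y`
    apply Affine.Point.map_injective (f := ι.toRatAlgHom)
    have e4 : Affine.Point.map (singularModuliField K ι).subtype.toRatAlgHom (∑ q, Pf q) =
        heegnerPointComplex D₀ H := by
      rw [map_sum, heegnerPointComplex]
      simp_rw [hPf]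
      exact Finset.sum_coe_sort H.reps (fun Q ↦ D₀.φ (heegnerTau Q))
    have hιY : Affine.Point.map ι.toRatAlgHom YK = heegnerPointComplex D₀ H := by
      rw [← e4, ← hYK]
      exact affinePoint_map_map_congr (Algebra.ofId K (singularModuliField K ι))
        (singularModuliField K ι).subtype.toRatAlgHom ι.toRatAlgHom (fun _ ↦ rfl) YK
    rw [hP, map_zsmul, map_zsmul, hιY, smul_comm, ModularParametrizationData.zsmul_heegnerPointComplex_eq D₀ Dt H,
      smul_smul, ← sq, ← sq_abs, hD₀, one_pow, one_smul]
  · -- `Y = z + ρ z` over `J`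
    apply Affine.Point.map_injective (f := (IntermediateField.fixedField S).val)
    have hρfun : ∀ x, ((θ γ₀).toAlgHom.comp (IntermediateField.fixedField S).val) x =
        (IntermediateField.fixedField S).val (ρ.toAlgHom x) := fun x ↦ (hρ x).symm
    have h2 : Affine.Point.map (IntermediateField.fixedField S).val (Affine.Point.map ρ.toAlgHom zJ) =
        Affine.Point.map (θ γ₀).toAlgHom (Affine.Point.map (IntermediateField.fixedField S).val zJ) :=
      (affinePoint_map_map_congr ρ.toAlgHom (IntermediateField.fixedField S).val _ hρfun zJ).symm.trans
        (affinePoint_map_map_congr (IntermediateField.fixedField S).val (θ γ₀).toAlgHom _ (fun _ ↦ rfl) zJ)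
    calc Affine.Point.map (IntermediateField.fixedField S).val
          (Affine.Point.map (Algebra.ofId K (IntermediateField.fixedField S)) YK)
        = Affine.Point.map (Algebra.ofId K (singularModuliField K ι)) YK :=
          (affinePoint_map_map_congr _ _ _ (fun _ ↦ rfl) YK).symm
      _ = ∑ q, Pf q := hYK
      _ = zH + Affine.Point.map (θ γ₀).toAlgHom zH := hdec
      _ = Affine.Point.map (IntermediateField.fixedField S).val zJ +
            Affine.Point.map (θ γ₀).toAlgHom (Affine.Point.map (IntermediateField.fixedField S).val zJ) := by
          rw [← hzJ]
      _ = Affine.Point.map (IntermediateField.fixedField S).val zJ +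
            Affine.Point.map (IntermediateField.fixedField S).val (Affine.Point.map ρ.toAlgHom zJ) := by rw [h2]
      _ = Affine.Point.map (IntermediateField.fixedField S).val (zJ + Affine.Point.map ρ.toAlgHom zJ) :=
          (map_add _ _ _).symm
  · -- the half-trace relation
    intro τ hτ
    let κ : IntermediateField.fixedField S →ₐ[ℚ] ℂ :=
      (singularModuliField K ι).subtype.toRatAlgHom.comp ((IntermediateField.fixedField S).val.restrictScalars ℚ)
    have hκ : ∀ x : IntermediateField.fixedField S, κ x = ((x : singularModuliField K ι) : ℂ) := fun _ ↦ rfl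
    apply Affine.Point.map_injective (f := κ)
    have hκz : Affine.Point.map κ zJ =
        ∑ Q ∈ H.reps.filter (fun Q ↦ ∃ δ, heegnerFormClass hK Q = δ ^ 2 * 1), D₀.φ (heegnerTau Q) :=
      (affinePoint_map_map_congr (IntermediateField.fixedField S).val (singularModuliField K ι).subtype.toRatAlgHom κ
        (fun _ ↦ rfl) zJ).trans
        ((congrArg (Affine.Point.map (singularModuliField K ι).subtype.toRatAlgHom) hzJ).trans
          (map_sum_filter_lifts H ι D₀ Pf hPf (fun Q ↦ ∃ δ, heegnerFormClass hK Q = δ ^ 2 * 1)))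
    have hτfun : ∀ x, (conjRatAlgHom.comp κ) x = κ (τ.toAlgHom x) := fun x ↦ (hτ x).symm
    have hκτ : Affine.Point.map κ (Affine.Point.map τ.toAlgHom zJ) = conjPoint cm7 (Affine.Point.map κ zJ) :=
      (affinePoint_map_map_congr τ.toAlgHom κ (conjRatAlgHom.comp κ) hτfun zJ).symm.trans
        (affinePoint_map_map_congr κ conjRatAlgHom (conjRatAlgHom.comp κ) (fun _ ↦ rfl) zJ)
    -- the class of the level ideal is a square (`N = 49 = 7²`)
    have hND : ∀ p : ℕ, p.Prime → p ∣ 49 → ¬ (p : ℤ) ∣ NumberField.discr K :=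
      fun p hp hpN ↦ not_dvd_discr_of_satisfiesHeegnerHypothesis hK hH hp hpN
    obtain ⟨Q₀, hQ₀⟩ := HeegnerDatum.reps_nonempty hK hH H
    have hν : ∃ μ, heegnerFormClass hK (((49 : ℕ) : ℤ), H.β, (H.β ^ 2 - NumberField.discr K) / (4 * (49 : ℕ))) =
        μ ^ 2 := by
      haveI : NeZero (7 : ℕ) := ⟨by norm_num⟩
      refine ⟨heegnerFormClass hK ((7 : ℕ), Q₀.2.1, (7 : ℕ) * (Q₀.1 / (49 : ℕ) * Q₀.2.2)), ?_⟩
      rw [← heegnerFormClass_levelForm_eq_datum hK hND H hQ₀]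
      exact heegnerFormClass_levelForm_eq_sq hK (by norm_num) hND (H.mem_heegnerForms Q₀ hQ₀).1
    have hbij := heegnerPoints_shimuraReciprocity.heegnerFormClass_bijective hSR hK hH D₀ H ι
    calc Affine.Point.map κ (zJ + Affine.Point.map τ.toAlgHom zJ)
        = Affine.Point.map κ zJ + conjPoint cm7 (Affine.Point.map κ zJ) := by rw [map_add, hκτ]
      _ = Affine.Point.some 2 (-1) (nonsingular_cm7_baseChange_two_neg_one ℂ) := by
          rw [hκz]; exact halfTrace_add_conj_eq_T hK hH D₀ H hW hν hbij hodd (cm7_twoTorsion_add_self ℂ) hcusp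
      _ = Affine.Point.map κ (Affine.Point.some 2 (-1) (nonsingular_cm7_baseChange_two_neg_one _)) :=
          (map_cm7_T κ).symm


/-- **All the genus-field data at once** (Theses-free interface for the datum): the field `J = H_K^{Cl²}` with
`[J : ℚ] = 4`, its involutions `ρ = θ(γ₀)|_J`, `τ = conj|_J`, the elements `√q`, `i`, the fixed field `ℚ(i)` of `ρτ`,
`√-7 ∉ J`, and the points: `P = c·c₀·Y`, `Y = z + ρ z`, `z + τ z = T`.
[cite: GrossLMS1991, Prop. 5.3 and proof] [cite: Darmon2004, Thm. 3.7] [cite: Cox2013, §3.A Prop. 3.11, §6.A Thm. 6.1] -/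
theorem exists_genusHalfTrace_data (hSR : heegnerPoints_shimuraReciprocity 49 cm7 K)
    (hK : IsImaginaryQuadratic K) (hH : SatisfiesHeegnerHypothesis 49 K) {q : ℕ} (hq : q.Prime)
    (hq4 : q % 4 = 1) (hq7 : q ≠ 7) (hdK : NumberField.discr K = -(4 * (q : ℤ)))
    (Dt D₀ : ModularParametrizationData cm7 49) (hD₀ : |D₀.c| = 1) (H : HeegnerDatum 49 (NumberField.discr K))
    (ι : K →+* ℂ) (hW : ModularForms.IsFrickeEigen 49 D₀.f ((-1 : ℤ) : ℂ))
    (hodd : Odd (Nat.card ((powMonoidHom 2 : ClassGroup (OrderCl.QO hK.negDiscr) →* _).range)))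
    (hcusp : D₀.cuspZeroPoint = Affine.Point.some 2 (-1) (nonsingular_cm7_baseChange_two_neg_one ℂ))
    {P : (cm7.baseChange K).toAffine.Point}
    (hP : Affine.Point.map ι.toRatAlgHom P = heegnerPointComplex Dt H) :
    ∃ (J : IntermediateField K (singularModuliField K ι)) (ρ τ : J ≃ₐ[ℚ] J) (sJ i : J)
      (z : (cm7.baseChange J).toAffine.Point) (Y : (cm7.baseChange K).toAffine.Point),
      Module.finrank ℚ J = 4 ∧ i ^ 2 = -1 ∧ sJ ^ 2 = (q : J) ∧ τ i = -i ∧ ρ i = -i ∧ τ sJ = sJ ∧ ρ sJ = -sJ ∧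
      (∀ x : J, ρ (τ x) = x → ∃ u v : ℚ, x = u + v * i) ∧ (∀ x : J, x ^ 2 ≠ -7) ∧
      P = Dt.c • (D₀.c • Y) ∧
      Affine.Point.map (algebraMap K J).toRatAlgHom Y = z + Affine.Point.map ρ.toAlgHom z ∧
      z + Affine.Point.map τ.toAlgHom z = Affine.Point.some 2 (-1) (nonsingular_cm7_baseChange_two_neg_one J) := by
  obtain ⟨θ, J, hJ, γ₀, hγ₀, ρK, hρ, z, Y, hPY, hYz, hzτ⟩ :=
    exists_genusHalfTrace_points hSR hK hH hq hq4 hdK Dt D₀ hD₀ H ι hW hodd hcusp hP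
  subst hJ
  have hJ2 := finrank_fixedField_map_range_sq hK ι θ hq hq4 hdK
  obtain ⟨τ, hτ⟩ := exists_algEquiv_conj_fixedField hK ι θ hq hq4 hdK
  -- `√q`
  have hmem : ((Real.sqrt q : ℝ) : ℂ) ∈ singularModuliField K ι := sqrt_mem_singularModuliField hK ι hq hq4 hdK
  have hs : (⟨_, hmem⟩ : singularModuliField K ι) ^ 2 = (q : singularModuliField K ι) := by
    apply Subtype.ext
    show ((Real.sqrt q : ℝ) : ℂ) ^ 2 = ((q : singularModuliField K ι) : ℂ)
    rw [← Complex.ofReal_pow, Real.sq_sqrt (Nat.cast_nonneg q)]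
    simp
  have hsJmem := sqrt_mem_fixedField_map_range_sq hK ι θ hs
  obtain ⟨sJ, hsJ_def⟩ : ∃ sJ : IntermediateField.fixedField
      (((powMonoidHom 2 : ClassGroup (OrderCl.QO hK.negDiscr) →* _).range).map θ.toMonoidHom),
      sJ = ⟨⟨_, hmem⟩, hsJmem⟩ := ⟨_, rfl⟩
  have hsr : ((sJ : singularModuliField K ι) : ℂ) = ((Real.sqrt q : ℝ) : ℂ) := by rw [hsJ_def]
  have hsJ : (sJ : singularModuliField K ι) ^ 2 = (q : singularModuliField K ι) := by rw [hsJ_def]; exact hs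
  have hsJ' : sJ ^ 2 = (q : IntermediateField.fixedField
      (((powMonoidHom 2 : ClassGroup (OrderCl.QO hK.negDiscr) →* _).range).map θ.toMonoidHom)) :=
    Subtype.ext (by push_cast; exact hsJ)
  -- `θ_K`, `σ_K`, `i`
  obtain ⟨θK, hθK⟩ := exists_sq_eq_neg_prime hK hdK
  obtain ⟨σK, -, hισ, hfix, hneg⟩ := exists_conj_imaginaryQuadratic hK ι hq hθK
  obtain ⟨i, hi, hqi⟩ := genusField_exists_i hq hθK hsJ
  -- `ρ` over `ℚ`
  have hρK : ∀ a : K, (ρK.restrictScalars ℚ) (algebraMap K _ a) = algebraMap K _ a := fun a ↦ ρK.commutes a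
  have hθγ₀ : θ γ₀ ∉ (((powMonoidHom 2 : ClassGroup (OrderCl.QO hK.negDiscr) →* _).range).map θ.toMonoidHom) :=
    fun h ↦ by
      obtain ⟨δ, hδ⟩ := (mem_map_range_sq_iff θ _).mp h
      exact hγ₀ δ (θ.injective hδ)
  have hρs : (ρK.restrictScalars ℚ) sJ = -sJ := by
    apply Subtype.ext
    rw [AlgEquiv.restrictScalars_apply, hρ]
    exact gal_apply_sqrt_eq_neg hK ι θ hq hq4 hdK hθγ₀ hsJ
  have hρi : (ρK.restrictScalars ℚ) i = -i := genusField_rho_apply_i hq hqi hρK hρs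
  refine ⟨_, ρK.restrictScalars ℚ, τ, sJ, i, z, Y, finrank_rat_eq_four hK hJ2, hi, hsJ', genusField_tau_apply_eq_neg_of_sq hi hτ,
    hρi, genusField_tau_apply_sqrt hsr hτ, hρs,
    exists_rat_of_rho_tau_fixed hK hq hdK hJ2 hισ hfix hneg hsr hqi hρK hρs hτ,
    sq_ne_neg_seven hK hq hq7 hdK hJ2 hθK hsJ, hPY, ?_, hzτ τ hτ⟩
  convert hYz using 1
  · exact affinePoint_map_congr _ _ (fun _ ↦ rfl) Y
  · congr 1

end Main



end Summit.BirchSwinnertonDyer.BirchSwinnertonDyer.Theorems.GoldfeldGoodTwists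

end
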